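import Literature.MathematicalPhysics.QuantumFieldTheory.Balaban1983to89.Node00.OpsYCubeDirInverse
import Literature.MathematicalPhysics.QuantumFieldTheory.Balaban1983to89.B9Thm311LocalInversePosY
import Literature.MathematicalPhysics.QuantumFieldTheory.Balaban1983to89.B9Thm311PositivityKnitLetter
import Literature.MathematicalPhysics.QuantumFieldTheory.Balaban1983to89.B9KnitTransporterUnitaryY

/-!
# `Balaban1983to89.B9CubeDirInversePosOnNearHY` — T. Bałaban, *Propagators for lattice gauge theories in a background field*, Commun. Math. Phys. **99** (1985)
# 389–434 [Balaban1985BackgroundPropagators] p. 394 L24–33 (`Δ′_a↾Ω₀ = Ω₀Δ′_aΩ₀`, «Its inverse is denoted by G′»), Thm 3.1 (3.36) p. 396 (positivity of `Δ′_a`),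
# Cor. 3.6 p. 408 + p. 408 L35 – p. 409 L5 (the sequence `{Ω_n(□)}`, `G′_□(U)`), Thm 3.11 p. 416: ★★ **THE COMPRESSED CUBE OPERATOR `Ω₀Δ′_{a,□}(U)Ω₀ ⊕ (1 − Ω₀)` IS A UNIT
# WHENEVER `Ω₀ ⊆ NearH(□)` AND THE MEMBER's `Δ′_a(U)` IS POSITIVE DEFINITE** — in particular at the knit transporter for every `U(N)`-valued background with unitary legs,
# with NO regime hypothesis: the `IsUnit (padDeltaCubeY …)` premise of node00-def-Y's `Node00.OpsYCubeDirInverse` (road P4) on such exteriors.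

statement-level skeleton of published theorems with citation tags; proofs where landed; nothing here is a claim about the Yang–Mills mass gap

WHY THIS FILE.  Every inverse identity of ✓`Node00.OpsYCubeDirInverse` (`G′_□(U) = GpDirY i □ par S U`) is guarded by `IsUnit (padDeltaCubeY i □ par S U)` — print's positivity
of the Dirichlet operator on `Ω₀(□)` (Thm 3.1 ∕ Cor. 3.6), displayed by the N06 knit certificate as `hUnitD` («KE₁₀X-A»).  On exteriors `S ⊆ NearH(□)` (r05's region where the
cube sequence's levels are the member's) the ROWS of `Δ′_{a,□}(U)` at the sites of `S` are those of the member's `Δ′_a(U)` (✓`B9CubeLettersOpsL0.deltaPrimeACubeY_apply_eq_of_nearH`),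
so `⟨Φ, Δ′_{a,□}(U)Φ⟩ = ⟨Φ, Δ′_a(U)Φ⟩` for `Φ` supported in `S` (the trace pairing is site-wise), and positivity of the compression follows from positivity of `Δ′_a(U)` — which at
the knit transporter holds for EVERY `U(N)`-valued background with unitary legs, no smallness (✓`B9Thm311PositivityKnitLetter.deltaPrimeAY_parKnitY_posDefTr`: `−Δ_U ≥ 0`, the
averaging term kills covariant constants).
* §1 `trIP_congr_of_apply` (the pairing `⟨Φ, Ψ⟩_w` reads `Ψ` only on `supp Φ`), ★ `posDefTr_dirPadY_cubeProjY_of_posOn` (the `D`-supported refinement of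
  ✓`B9Thm311LocalInversePosY.posDefTr_dirPadY_cubeProjY`: positivity of `T` on `D`-supported inputs suffices).
* §2 ★ `trIP_deltaPrimeACubeY_eq_of_nearH`, ★ `isUnit_padDeltaCubeY_of_nearH_of_posDefTr` (any transporter `par`, any weight), `isUnit_padDeltaCubeY_parKnitY_of_nearH`
  (`G ≤ U(N)`, `U` and the knit legs `G`-valued), ★★ `isUnit_padDeltaCubeY_parKnitY_of_nearH_of_le` (`U` `G`-valued, `G ≤ U(N)` — NO leg hypothesis: the legs are
  `U(N)`-valued for every unitary field by ✓`B9KnitTransporterUnitaryY.parKnitY_mem_unitaryUnits_of_le` ∕ ✓`B7UnitaryAveragesAllRadii`).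
* §3 (v1.1) ★ `posOn_deltaPrimeACubeY_of_compl`, ★★ `isUnit_padDeltaCubeY_of_compl`, ★★ `isUnit_padDeltaCubeY_parKnitY_of_compl`: on EVERY PROPER exterior `Ω₀ ⊊ T_η`
  (print's `Ω₀(□) ⊋ NearH(□)` included) the unit premise from r05's sum-of-squares form + def-Y's taxicab transport of flat sections — NO `NearH`, no regime.
* §4 (v1.2) `nearH_wit` (the member's level-`j` witness of `β` is near □), ★★ `deltaPrimeACubeY_parKnitY_trIP_pos` ∕ `deltaPrimeACubeY_parKnitY_posDefTr` (`Δ′_{a,□}(U; parKnitY)`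
  is positive definite on the WHOLE torus for every `G`-valued background, `G ≤ U(N)`: the block of the cube sequence through the witness is a member block near □, on which the
  knit legs transport flat sections to the corner — dag-n06-j ✓`parKnitY_corner_transport`, r05 ✓`B9CubeCoarsening`), ★★★ `isUnit_padDeltaCubeY_parKnitY`: the unit premise on
  EVERY exterior `Ω₀ ⊆ T_η`, proper or not (print's placement `Ω₀(□) = dirDomC` may wrap around a small torus) — NO cover-geometry hypothesis at all (supersedes §3's `∃ w ∉ Ω₀`).
HONEST SCOPE.  Finite-dimensional positivity algebra over landed theorems; no estimate of [B9] (the CONSTANTS of Thm 3.1 ∕ Cor. 3.6 for `G′_□` are not touched — only invertibility);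
the inclusion `Ω₀(□) ⊆ NearH(□)` is a HYPOTHESIS (cover geometry, dag-n06-c's D3 placement).  Count-neutral; N06 NOT discharged; nothing continuum ∕ OS ∕ mass gap ∕ Clay.  Cell
`pub-ymgap` (D-0062), Track A node N06 [B9], seat `pub-ymgap-dag-n06-d` (g32), 2026-08-31; v1.1 ∕ v1.2 append-only (§3, §4), earlier declarations byte-identical.
-/

noncomputable section

namespace Literature.MathematicalPhysics.QuantumFieldTheory.Balaban1983to89.B9CubeDirInversePosOnNearHY

open B9Thm311ReadingCoords B9Thm311DeltaPrimePos
open B9Thm311LocalInversePosY (trIP_dirPadY_cubeProjY_eq cubeProjY_compl_eq_self_of)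
open B6KLevelCensusIndexV1 (KIdx)
open B6Cover236MultiLevelBlocks (cubes)
open B9CubeSequence408 (NearH)
open B9CubeLettersOpsL0 (deltaPrimeACubeY deltaPrimeACubeY_apply_eq_of_nearH)
open B9Thm311PositivityKnitLetter (deltaPrimeAY_parKnitY_posDefTr)
open B9B8AveragingJunction (parKnitY)
open B9KnitTransporterUnitaryY (parKnitY_mem_unitaryUnits_of_le)
open Node00
open Node00.OpsYLocalInverse (dirPadY cubeProjY cubeProjY_apply)
open Node00.OpsYCubeDirInverse (padDeltaCubeY)
open scoped Matrix Matrix.Norms.L2Operator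

variable {d ℓ : ℕ} {hd : 1 ≤ d + 1} {hL : Odd (ℓ + 1) ∧ 1 < ℓ + 1} {b₀ b₁ : ℝ} {N : ℕ}
variable (i : KIdx d ℓ hd hL b₀ b₁)

/-! ## §1 Positivity of a padded compression from positivity on `D`-supported inputs -/

/-- the trace pairing `⟨Φ, Ψ⟩_w` reads `Ψ` only where `Φ ≠ 0`. [cite: Balaban1985BackgroundPropagators, p.393 (scalar products), bookkeeping] -/
theorem trIP_congr_of_apply (w : SiteY i → ℝ) (Φ Ψ Ψ' : SiteY i → Matrix (Fin N) (Fin N) ℂ) (h : ∀ z, Φ z ≠ 0 → Ψ z = Ψ' z) :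
    trIP w Φ Ψ = trIP w Φ Ψ' := by
  unfold trIP
  refine Finset.sum_congr rfl fun z _ => ?_
  by_cases hz : Φ z = 0
  · simp [hz]
  · rw [h z hz]

/-- ★ **COMPRESSION TO `D` IS POSITIVE DEFINITE AS SOON AS `T` IS POSITIVE ON `D`-SUPPORTED INPUTS**: `⟨Φ, (P_D T P_D + 1 − P_D)Φ⟩_w = ⟨P_DΦ, T P_DΦ⟩_w + ‖P_{D^c}Φ‖²_w`
(the refinement of ✓`posDefTr_dirPadY_cubeProjY`, whose hypothesis is positivity on all inputs). [cite: Balaban1985BackgroundPropagators, (3.79) p.406, Thm 3.11 p.416, p.394 L24–33] -/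
theorem posDefTr_dirPadY_cubeProjY_of_posOn {w : SiteY i → ℝ} (hw : ∀ s, 0 < w s) (D : Finset (SiteY i))
    {T : Module.End ℂ (SiteY i → Matrix (Fin N) (Fin N) ℂ)}
    (hT : ∀ Φ : SiteY i → Matrix (Fin N) (Fin N) ℂ, (∀ z, z ∉ D → Φ z = 0) → Φ ≠ 0 → 0 < trIP w Φ (T Φ)) :
    PosDefTr w (dirPadY (cubeProjY i D) T) := by
  intro Φ hΦ
  rw [trIP_dirPadY_cubeProjY_eq]
  by_cases hP : cubeProjY i D Φ = 0
  · rw [hP, map_zero, trIP_zero_right, zero_add, cubeProjY_compl_eq_self_of i D hP]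
    exact trIP_self_pos w hw hΦ
  · exact add_pos_of_pos_of_nonneg (hT _ (fun z hz => by rw [cubeProjY_apply, if_neg hz]) hP) (trIP_self_nonneg w hw _)

/-! ## §2 On exteriors inside `NearH(□)`: the unit premise of `G′_□(U)` from positivity of the member's `Δ′_a(U)` -/

section NearH

variable (q : ↥(cubes (toKT i).D.toDomains))

/-- ★ for `Φ` supported in `D ⊆ NearH(□)`: `⟨Φ, Δ′_{a,□}(U)Φ⟩_w = ⟨Φ, Δ′_a(U)Φ⟩_w` (ROW agreement near □, pairing site-wise).
[cite: Balaban1985BackgroundPropagators, (3.88) p.409, (3.24) p.394, pp.408–409] -/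
theorem trIP_deltaPrimeACubeY_eq_of_nearH (w : SiteY i → ℝ) (par : SiteParY (Matrix (Fin N) (Fin N) ℂ) i) (U : CfgY (Matrix (Fin N) (Fin N) ℂ) i)
    {D : Finset (SiteY i)} (hD : ∀ z ∈ D, NearH q z.1) (Φ : SiteY i → Matrix (Fin N) (Fin N) ℂ) (hΦD : ∀ z, z ∉ D → Φ z = 0) :
    trIP w Φ (deltaPrimeACubeY i q par U Φ) = trIP w Φ (deltaPrimeAY i par U Φ) :=
  trIP_congr_of_apply i w Φ _ _ fun z hz =>
    deltaPrimeACubeY_apply_eq_of_nearH i q par U Φ (hD z (by by_contra h; exact hz (hΦD z h)))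

/-- ★ **THE UNIT PREMISE OF `G′_□(U)` ON `Ω₀ ⊆ NearH(□)` FROM POSITIVITY OF THE MEMBER's `Δ′_a(U)`** (any transporter, any positive weight): `IsUnit (Ω₀Δ′_{a,□}(U)Ω₀ ⊕ 1)`.
[cite: Balaban1985BackgroundPropagators, p.394 L24–33 («Its inverse is denoted by G′»), Thm 3.1 (3.36) p.396, Cor. 3.6 p.408] -/
theorem isUnit_padDeltaCubeY_of_nearH_of_posDefTr (par : SiteParY (Matrix (Fin N) (Fin N) ℂ) i) {D : Finset (SiteY i)} (hD : ∀ z ∈ D, NearH q z.1)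
    {U : CfgY (Matrix (Fin N) (Fin N) ℂ) i} {w : SiteY i → ℝ} (hw : ∀ s, 0 < w s) (hpos : PosDefTr w (deltaPrimeAY i par U)) :
    IsUnit (padDeltaCubeY i q par D U) :=
  isUnit_of_posDefTr (posDefTr_dirPadY_cubeProjY_of_posOn i hw D fun Φ hΦD hΦ => by
    rw [trIP_deltaPrimeACubeY_eq_of_nearH i q w par U hD Φ hΦD]
    exact hpos Φ hΦ)

variable {G : Subgroup (Matrix (Fin N) (Fin N) ℂ)ˣ}

/-- ★★ **AT THE KNIT TRANSPORTER, FOR EVERY `G`-VALUED BACKGROUND WITH `G`-VALUED LEGS (`G ≤ U(N)`) AND EVERY EXTERIOR `Ω₀ ⊆ NearH(□)`: `IsUnit (Ω₀Δ′_{a,□}(U; parKnitY)Ω₀ ⊕ 1)`**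
— no regime, no smallness (✓`deltaPrimeAY_parKnitY_posDefTr`; the legs are `U(N)`-valued for every unitary field by ✓`B9KnitTransporterUnitaryY`). The `hUnitD` row of the N06 knit
certificate at `O := GpDirY … (parKnitY …) (S □)` on such exteriors. [cite: Balaban1985BackgroundPropagators, Thm 3.1 (3.36) p.396, Cor. 3.6 p.408, p.394 L24–33, (3.19) p.393] -/
theorem isUnit_padDeltaCubeY_parKnitY_of_nearH (hG : G ≤ B7Prop2Explicit.unitaryUnits (Matrix (Fin N) (Fin N) ℂ))
    {U : CfgY (Matrix (Fin N) (Fin N) ℂ) i} (hU : ∀ μ x, U μ x ∈ G) (hpar : ∀ z w : SiteY i, parKnitY i U z w ∈ G)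
    {D : Finset (SiteY i)} (hD : ∀ z ∈ D, NearH q z.1) : IsUnit (padDeltaCubeY i q (parKnitY i) D U) :=
  isUnit_padDeltaCubeY_of_nearH_of_posDefTr i q (parKnitY i) hD (fun _ => one_pos) (deltaPrimeAY_parKnitY_posDefTr i hG hU hpar)

/-- ★★ **THE SAME WITH NO LEG HYPOTHESIS**: for every `G`-valued background, `G ≤ U(N)`, and every exterior `Ω₀ ⊆ NearH(□)`, `IsUnit (Ω₀Δ′_{a,□}(U; parKnitY)Ω₀ ⊕ 1)` — the
knit legs are `U(N)`-valued for every unitary field (node00-def-Y's ✓`B9KnitTransporterUnitaryY.parKnitY_mem_unitaryUnits_of_le` over ✓`B7UnitaryAveragesAllRadii`: [5] (22)–(23)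
at every radius).  The `hUnitD` row of «KE₁₀X-A» ∕ «KESC-AD» reduced to the cover geometry `S □ ⊆ NearH □`.
[cite: Balaban1985BackgroundPropagators, Thm 3.1 (3.36) p.396, Cor. 3.6 p.408, p.394 L24–33, (3.19) p.393; Balaban1985Averaging, (22)–(23) p.21] -/
theorem isUnit_padDeltaCubeY_parKnitY_of_nearH_of_le (hGU : G ≤ B7Prop2Explicit.unitaryUnits (Matrix (Fin N) (Fin N) ℂ))
    {U : CfgY (Matrix (Fin N) (Fin N) ℂ) i} (hU : ∀ μ x, U μ x ∈ G) {D : Finset (SiteY i)} (hD : ∀ z ∈ D, NearH q z.1) :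
    IsUnit (padDeltaCubeY i q (parKnitY i) D U) :=
  isUnit_padDeltaCubeY_parKnitY_of_nearH i q le_rfl (fun μ x => hGU (hU μ x)) (parKnitY_mem_unitaryUnits_of_le i hGU hU) hD

end NearH

/-! ## §3 (v1.1) On EVERY PROPER exterior `Ω₀ ⊊ T_η`: the unit premise from the sum-of-squares form alone (print's `Ω₀(□) ⊋ NearH(□)`) -/

section Proper

open B9Thm311CubeLettersFirstThree (trIP_deltaPrimeACubeY_eq levC_wCube_pos)
open B9CubeLettersBondOpsL0 (BlkCubeY blkCornerCubeY)
open B9CubeLettersOpsL0 (cubeFamY)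
open B6Geom246MultiLevelBoxL0 (blkOf)
open B6MultiLevelBoxOperator (levC)
open B9Thm31CubeLocalFlat (wCube)
open B9Thm311DeltaPrimePos (R_parSY_of_cdS_eq_zero re_trace_conjTranspose_mul_self_nonneg)
open B9Eq39Adjoint (R R_zero)
open B9B8AveragingJunction (parKnitY_inv)

variable (q : ↥(cubes (toKT i).D.toDomains)) {G : Subgroup (Matrix (Fin N) (Fin N) ℂ)ˣ}

/-- ★ **`Δ′_{a,□}(U)` IS POSITIVE ON FIELDS SUPPORTED IN A PROPER EXTERIOR `Ω₀ ⊊ T_η`** — any inverse-symmetric `G`-valued transporter table (`G ≤ U(N)`), any `G`-valued `U`,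
NO `NearH` hypothesis: by r05's sum of squares (✓`trIP_deltaPrimeACubeY_eq`: `⟨Φ,Δ′_{a,□}Φ⟩ = Σ_μ‖∇_{U,μ}Φ‖² + Σ_s c_s‖B_s‖²`, `c_s > 0`) a vanishing form makes `Φ` a FLAT
section, and a flat section vanishing at one site `w ∉ Ω₀` vanishes everywhere (def-Y's taxicab transporter carries flat sections between ANY two sites,
✓`B9Thm311DeltaPrimePos.R_parSY_of_cdS_eq_zero`).  This is the reading matching print's Dirichlet exterior `Ω₀(□) ⊃ C₁(□) ⊋ NearH(□)` (dag-n06-c's placement `dirDomC`), where §2's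
row-agreement route does not apply. [cite: Balaban1985BackgroundPropagators, (3.23)–(3.24) pp.394–395, p.394 L24–33, Thm 3.1 (3.36) p.396, Thm 3.11 p.416] -/
theorem posOn_deltaPrimeACubeY_of_compl (hG : G ≤ B7Prop2Explicit.unitaryUnits (Matrix (Fin N) (Fin N) ℂ)) (par : SiteParY (Matrix (Fin N) (Fin N) ℂ) i)
    {U : CfgY (Matrix (Fin N) (Fin N) ℂ) i} (hinv : ∀ z z' : SiteY i, par U z z' = (par U z' z)⁻¹) (hpar : ∀ z w : SiteY i, par U z w ∈ G) (hU : ∀ μ x, U μ x ∈ G)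
    {D : Finset (SiteY i)} (hD : ∃ w : SiteY i, w ∉ D) (Φ : SiteY i → Matrix (Fin N) (Fin N) ℂ) (hΦD : ∀ z, z ∉ D → Φ z = 0) (hΦ : Φ ≠ 0) :
    0 < trIP (fun _ => (1 : ℝ)) Φ (deltaPrimeACubeY i q par U Φ) := by
  have hl : ∀ μ, 0 ≤ trIP (fun _ => (1 : ℝ)) (cdS i U μ Φ) (cdS i U μ Φ) := fun μ => trIP_self_nonneg _ (fun _ => one_pos) _
  have ha : ∀ s : BlkCubeY i q, 0 ≤ levC d ℓ (wCube ℓ) s.1.1 *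
      (Matrix.trace ((∑ z ∈ Finset.univ.filter (fun z : SiteY i => blkOf (cubeFamY i q).toDomains z = s), R (par U (blkCornerCubeY i q s) z) (Φ z))ᴴ *
        ∑ z ∈ Finset.univ.filter (fun z : SiteY i => blkOf (cubeFamY i q).toDomains z = s), R (par U (blkCornerCubeY i q s) z) (Φ z))).re := fun s =>
    mul_nonneg (levC_wCube_pos (B9Cor35AtOneInverseLetters.one_le_ell i) s.1.1).le (re_trace_conjTranspose_mul_self_nonneg _)
  have hlap := Finset.sum_nonneg fun μ (_ : μ ∈ Finset.univ) => hl μ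
  have havg := Finset.sum_nonneg fun s (_ : s ∈ Finset.univ) => ha s
  rw [trIP_deltaPrimeACubeY_eq i q hG par U hinv hpar hU Φ]
  refine (add_nonneg hlap havg).lt_of_ne fun h0 => hΦ ?_
  -- a vanishing form makes `Φ` flat
  have hcd : ∀ μ, cdS i U μ Φ = 0 := fun μ => by
    by_contra hne
    have h := (Finset.sum_eq_zero_iff_of_nonneg fun μ _ => hl μ).1 (by linarith) μ (Finset.mem_univ μ)
    exact (trIP_self_pos (fun _ : SiteY i => (1 : ℝ)) (fun _ => one_pos) hne).ne' h
  -- a flat section vanishing off `D` vanishes everywhere (taxicab transport between any two sites)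
  obtain ⟨w, hw⟩ := hD
  funext z
  have h := R_parSY_of_cdS_eq_zero i U hcd z w
  rw [hΦD w hw, R_zero] at h
  exact h.symm

/-- ★★ **THE UNIT PREMISE OF `G′_□(U)` ON EVERY PROPER EXTERIOR**: `IsUnit (Ω₀Δ′_{a,□}(U)Ω₀ ⊕ 1)` for `Ω₀ ⊊ T_η`, any inverse-symmetric `G`-valued transporter table, any
`G`-valued `U`, `G ≤ U(N)` — no regime, no `NearH`. [cite: Balaban1985BackgroundPropagators, p.394 L24–33 («Its inverse is denoted by G′»), (3.24) pp.394–395, Thm 3.11 p.416] -/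
theorem isUnit_padDeltaCubeY_of_compl (hG : G ≤ B7Prop2Explicit.unitaryUnits (Matrix (Fin N) (Fin N) ℂ)) (par : SiteParY (Matrix (Fin N) (Fin N) ℂ) i)
    {U : CfgY (Matrix (Fin N) (Fin N) ℂ) i} (hinv : ∀ z z' : SiteY i, par U z z' = (par U z' z)⁻¹) (hpar : ∀ z w : SiteY i, par U z w ∈ G) (hU : ∀ μ x, U μ x ∈ G)
    {D : Finset (SiteY i)} (hD : ∃ w : SiteY i, w ∉ D) : IsUnit (padDeltaCubeY i q par D U) :=
  isUnit_of_posDefTr (posDefTr_dirPadY_cubeProjY_of_posOn i (fun _ => one_pos) D fun Φ hΦD hΦ =>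
    posOn_deltaPrimeACubeY_of_compl i q hG par hinv hpar hU hD Φ hΦD hΦ)

/-- ★★ **AT THE KNIT TRANSPORTER, EVERY `G`-VALUED BACKGROUND (`G ≤ U(N)`), EVERY PROPER EXTERIOR**: `IsUnit (Ω₀Δ′_{a,□}(U; parKnitY)Ω₀ ⊕ 1)` — the knit table is
inverse-symmetric (✓`parKnitY_inv`) and `U(N)`-valued for every unitary field (node00-def-Y ✓`B9KnitTransporterUnitaryY.parKnitY_mem_unitaryUnits_of_le`).  The `hUnitD` row of
«KE₁₀X-A» ∕ «KESC-AD» reduced to `∃ w, w ∉ S x □` (print's `Ω₀(□)` is a proper box of `T_η`).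
[cite: Balaban1985BackgroundPropagators, p.394 L24–33, (3.24) pp.394–395, Thm 3.11 p.416, (3.19) p.393; Balaban1985Averaging, (22)–(23) p.21] -/
theorem isUnit_padDeltaCubeY_parKnitY_of_compl (hGU : G ≤ B7Prop2Explicit.unitaryUnits (Matrix (Fin N) (Fin N) ℂ))
    {U : CfgY (Matrix (Fin N) (Fin N) ℂ) i} (hU : ∀ μ x, U μ x ∈ G) {D : Finset (SiteY i)} (hD : ∃ w : SiteY i, w ∉ D) :
    IsUnit (padDeltaCubeY i q (parKnitY i) D U) :=
  isUnit_padDeltaCubeY_of_compl i q le_rfl (parKnitY i) (parKnitY_inv i U) (parKnitY_mem_unitaryUnits_of_le i hGU hU)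
    (fun μ x => hGU (hU μ x)) hD

end Proper

/-! ## §4 (v1.2) On EVERY exterior `Ω₀ ⊆ T_η`, proper or not: the unit premise at the knit transporter from the block of □'s own witness -/

section Every

open B9Thm311CubeLettersFirstThree (trIP_deltaPrimeACubeY_eq levC_wCube_pos)
open B9CubeLettersBondOpsL0 (BlkCubeY blkCornerCubeY)
open B9CubeLettersOpsL0 (cubeFamY oddMh two_le_R)
open B9Thm311DeltaPrimePos (R_parSY_of_cdS_eq_zero re_trace_conjTranspose_mul_self_nonneg eq_zero_of_re_trace_conjTranspose_mul_self_eq_zero)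
open B9Thm311PositivityKnitLetter (parKnitY_corner_transport)
open B9Eq39Adjoint (R R_zero)
open B9B8AveragingJunction (parKnitY_inv)
open B6Cover236MultiLevelBlocks (wit blk_wit)
open B9Cor36CubeCutoffs (NearC SC nearH_of_nearC)
open B9CubeSequence408 (abs_sub_ctrC_le_of_blk_eq two_mul_hf_add_one sI_pos sI hf)
open B9CubeCoarsening (blkOf_eq_of_cube_blkOf_eq coarsen_blkOf_val_of_nearH)
open B4TorusKernel.MultiPeriod (circAbs_le_abs)
open B6MultiLevelBoxOperator (levC)
open B6MultiLevelTorusOperator (one_le_N0)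
open B9Thm31CubeLocalFlat (wCube)

variable (q : ↥(cubes (toKT i).D.toDomains)) {G : Subgroup (Matrix (Fin N) (Fin N) ℂ)ˣ}

/-- the member's level-`j` witness of `β` (a site of □ carrying the global level `j`) is within `S_j` of the centre of □, hence near □.
[cite: Balaban1985BackgroundPropagators, p.408 («a cube with a center at the center of □»); Balaban1984PropagatorsII, p.229 («with a center y ∈ Λ_j»)] -/
theorem nearH_wit : NearH q (wit (toKT i).D.toDomains q).1 := by
  have hS := sI_pos (ℓ := ℓ) (toKT i).hMh q.1.1
  have h2 := two_mul_hf_add_one hL.1 (oddMh i) q.1.1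
  refine nearH_of_nearC i q (r := SC i q) (by show sI ℓ (toKT i).Mh q.1.1 ≤ 3 * sI ℓ (toKT i).Mh q.1.1; omega) fun μ => ?_
  have hN : 1 ≤ (toKT i).NB μ := one_le_N0 (toKT i).hMh (toKT i).hP μ
  refine (circAbs_le_abs hN _).trans ((abs_sub_ctrC_le_of_blk_eq hL.1 (oddMh i) (toKT i).hMh q (blk_wit _ q) μ).trans ?_)
  show hf ℓ (toKT i).Mh q.1.1 ≤ sI ℓ (toKT i).Mh q.1.1
  omega

/-- ★★ **`Δ′_{a,□}(U; parKnitY)` IS POSITIVE DEFINITE ON THE WHOLE TORUS, FOR EVERY `G`-VALUED BACKGROUND (`G ≤ U(N)`)** — no exterior point, no `NearH`, no smallness: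
by r05's sum of squares (✓`trIP_deltaPrimeACubeY_eq`) a vanishing form makes `Φ` flat and kills every transported block sum of the cube sequence; the block of the
cube sequence through □'s witness lies near □, where the cube sequence has the member's levels (✓`coarsen_blkOf_val_of_nearH`), so it IS the member block there, its
corner is the member corner, and on it the knit legs DO transport flat sections to the corner (dag-n06-j ✓`parKnitY_corner_transport`; every site of that cube block has
that member block, ✓`blkOf_eq_of_cube_blkOf_eq`) — so that block sum is `|s|·Φ(c_s) = 0`, and a flat section vanishing at one site vanishes everywhere (def-Y's taxicab
transport ✓`R_parSY_of_cdS_eq_zero`).  The mismatch of the member-keyed legs elsewhere on `Ω₀(□) ∖ NearH(□)` (the (T-□) word) is immaterial for positivity.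
[cite: Balaban1985BackgroundPropagators, (3.24) pp.394–395, p.394 L24–33, Thm 3.1 (3.36) p.396, Thm 3.11 p.416, p.408–409 (the sequence {Ω_n(□)}), (3.19) p.393] -/
theorem deltaPrimeACubeY_parKnitY_trIP_pos (hGU : G ≤ B7Prop2Explicit.unitaryUnits (Matrix (Fin N) (Fin N) ℂ)) {U : CfgY (Matrix (Fin N) (Fin N) ℂ) i}
    (hU : ∀ μ x, U μ x ∈ G) (Φ : SiteY i → Matrix (Fin N) (Fin N) ℂ) (hΦ : Φ ≠ 0) :
    0 < trIP (fun _ => (1 : ℝ)) Φ (deltaPrimeACubeY i q (parKnitY i) U Φ) := by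
  have hU' : ∀ μ x, U μ x ∈ B7Prop2Explicit.unitaryUnits (Matrix (Fin N) (Fin N) ℂ) := fun μ x => hGU (hU μ x)
  have hparG := parKnitY_mem_unitaryUnits_of_le i hGU hU
  have hl : ∀ μ, 0 ≤ trIP (fun _ => (1 : ℝ)) (cdS i U μ Φ) (cdS i U μ Φ) := fun μ => trIP_self_nonneg _ (fun _ => one_pos) _
  have ha : ∀ s : BlkCubeY i q, 0 ≤ levC d ℓ (wCube ℓ) s.1.1 *
      (Matrix.trace ((∑ z ∈ Finset.univ.filter (fun z : SiteY i => B6Geom246MultiLevelBoxL0.blkOf (cubeFamY i q).toDomains z = s),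
          R (parKnitY i U (blkCornerCubeY i q s) z) (Φ z))ᴴ *
        ∑ z ∈ Finset.univ.filter (fun z : SiteY i => B6Geom246MultiLevelBoxL0.blkOf (cubeFamY i q).toDomains z = s),
          R (parKnitY i U (blkCornerCubeY i q s) z) (Φ z))).re := fun s =>
    mul_nonneg (levC_wCube_pos (B9Cor35AtOneInverseLetters.one_le_ell i) s.1.1).le (re_trace_conjTranspose_mul_self_nonneg _)
  have hlap := Finset.sum_nonneg fun μ (_ : μ ∈ Finset.univ) => hl μ
  have havg := Finset.sum_nonneg fun s (_ : s ∈ Finset.univ) => ha s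
  rw [trIP_deltaPrimeACubeY_eq i q le_rfl (parKnitY i) U (parKnitY_inv i U) hparG hU' Φ]
  refine (add_nonneg hlap havg).lt_of_ne fun h0 => hΦ ?_
  -- (i) a vanishing form makes `Φ` flat
  have hcd : ∀ μ, cdS i U μ Φ = 0 := fun μ => by
    by_contra hne
    have h := (Finset.sum_eq_zero_iff_of_nonneg fun μ _ => hl μ).1 (by linarith) μ (Finset.mem_univ μ)
    exact (trIP_self_pos (fun _ : SiteY i => (1 : ℝ)) (fun _ => one_pos) hne).ne' h
  -- (ii) the block of the cube sequence through □'s witness `z₀`: its transported block sum vanishes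
  have hB : ∀ s : BlkCubeY i q,
      ∑ z ∈ Finset.univ.filter (fun z : SiteY i => B6Geom246MultiLevelBoxL0.blkOf (cubeFamY i q).toDomains z = s),
        R (parKnitY i U (blkCornerCubeY i q s) z) (Φ z) = 0 := fun s => by
    have h := (Finset.sum_eq_zero_iff_of_nonneg fun s _ => ha s).1 (by linarith) s (Finset.mem_univ s)
    exact eq_zero_of_re_trace_conjTranspose_mul_self_eq_zero
      ((mul_eq_zero.1 h).resolve_left (levC_wCube_pos (B9Cor35AtOneInverseLetters.one_le_ell i) s.1.1).ne')
  -- (iii) near □ that cube block is the member block of `z₀`, with the member corner, and the knit legs transport to it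
  have hval : (B6Geom246MultiLevelBox.blkOf i.D.toDomains (wit (toKT i).D.toDomains q)).1 =
      (B6Geom246MultiLevelBoxL0.blkOf (cubeFamY i q).toDomains (wit (toKT i).D.toDomains q)).1 :=
    coarsen_blkOf_val_of_nearH (D := (toKT i).D) (hL := hL.1) (hM := oddMh i) (hMh := (toKT i).hMh) (hP := (toKT i).hP) (two_le_R i) (nearH_wit i q)
  have hcorner : blkCornerCubeY i q (B6Geom246MultiLevelBoxL0.blkOf (cubeFamY i q).toDomains (wit (toKT i).D.toDomains q)) =
      blkCornerY i (B6Geom246MultiLevelBox.blkOf i.D.toDomains (wit (toKT i).D.toDomains q)) := by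
    apply Subtype.ext
    show B6Geom246MultiLevelBoxL0.corner (cubeFamY i q).toDomains _ = B6Geom246MultiLevelBox.corner i.D.toDomains _
    funext μ
    simp only [B6Geom246MultiLevelBoxL0.corner, B6Geom246MultiLevelBox.corner, ← hval]
  have hterm : ∀ z ∈ Finset.univ.filter (fun z : SiteY i => B6Geom246MultiLevelBoxL0.blkOf (cubeFamY i q).toDomains z =
      B6Geom246MultiLevelBoxL0.blkOf (cubeFamY i q).toDomains (wit (toKT i).D.toDomains q)),
      R (parKnitY i U (blkCornerCubeY i q (B6Geom246MultiLevelBoxL0.blkOf (cubeFamY i q).toDomains (wit (toKT i).D.toDomains q))) z) (Φ z) =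
        Φ (blkCornerY i (B6Geom246MultiLevelBox.blkOf i.D.toDomains (wit (toKT i).D.toDomains q))) := fun z hz => by
    have hz' := (Finset.mem_filter.1 hz).2
    unfold cubeFamY at hz'
    rw [hcorner]
    exact parKnitY_corner_transport i U Φ hcd (blkOf_eq_of_cube_blkOf_eq hz')
  -- (iv) so `Φ` vanishes at that corner
  have hc0 : Φ (blkCornerY i (B6Geom246MultiLevelBox.blkOf i.D.toDomains (wit (toKT i).D.toDomains q))) = 0 := by
    have h := hB (B6Geom246MultiLevelBoxL0.blkOf (cubeFamY i q).toDomains (wit (toKT i).D.toDomains q))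
    rw [Finset.sum_congr rfl hterm, Finset.sum_const, ← Nat.cast_smul_eq_nsmul ℂ] at h
    refine (smul_eq_zero.1 h).resolve_left (Nat.cast_ne_zero.2 (Finset.card_ne_zero.2 ⟨wit (toKT i).D.toDomains q, ?_⟩))
    rw [Finset.mem_filter]
    exact ⟨Finset.mem_univ _, rfl⟩
  -- (v) a flat section vanishing at one site vanishes everywhere
  funext z
  have h := R_parSY_of_cdS_eq_zero i U hcd z (blkCornerY i (B6Geom246MultiLevelBox.blkOf i.D.toDomains (wit (toKT i).D.toDomains q)))
  rw [hc0, R_zero] at h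
  exact h.symm

/-- ★★ hence `Δ′_{a,□}(U; parKnitY)` is positive definite (`PosDefTr 1`) for every `G`-valued background, `G ≤ U(N)` — the cube-sequence twin of dag-n06-j's
✓`deltaPrimeAY_parKnitY_posDefTr`. [cite: Balaban1985BackgroundPropagators, (3.24) pp.394–395, Thm 3.11 p.416, p.409 («G′_□(U)»)] -/
theorem deltaPrimeACubeY_parKnitY_posDefTr (hGU : G ≤ B7Prop2Explicit.unitaryUnits (Matrix (Fin N) (Fin N) ℂ)) {U : CfgY (Matrix (Fin N) (Fin N) ℂ) i}
    (hU : ∀ μ x, U μ x ∈ G) : PosDefTr (fun _ => (1 : ℝ)) (deltaPrimeACubeY i q (parKnitY i) U) := fun Φ hΦ =>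
  deltaPrimeACubeY_parKnitY_trIP_pos i q hGU hU Φ hΦ

/-- ★★★ **THE UNIT PREMISE OF `G′_□(U)` ON EVERY EXTERIOR**: `IsUnit (Ω₀Δ′_{a,□}(U; parKnitY)Ω₀ ⊕ 1)` for EVERY `Ω₀ ⊆ T_η` (proper or not — in particular print's
placement `Ω₀(□) = dirDomC`, whose mirror box may wrap around a small torus) and every `G`-valued background, `G ≤ U(N)`: the `hUnitD` row of the N06 knit certificates
with NO cover-geometry hypothesis (supersedes §3's `∃ w, w ∉ Ω₀`). [cite: Balaban1985BackgroundPropagators, p.394 L24–33 («Its inverse is denoted by G′»), (3.24) pp.394–395, Cor. 3.6 p.408, p.409, Thm 3.11 p.416] -/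
theorem isUnit_padDeltaCubeY_parKnitY (hGU : G ≤ B7Prop2Explicit.unitaryUnits (Matrix (Fin N) (Fin N) ℂ)) {U : CfgY (Matrix (Fin N) (Fin N) ℂ) i}
    (hU : ∀ μ x, U μ x ∈ G) (D : Finset (SiteY i)) : IsUnit (padDeltaCubeY i q (parKnitY i) D U) :=
  isUnit_of_posDefTr (posDefTr_dirPadY_cubeProjY_of_posOn i (fun _ => one_pos) D fun Φ _ hΦ =>
    deltaPrimeACubeY_parKnitY_trIP_pos i q hGU hU Φ hΦ)

end Every

end Literature.MathematicalPhysics.QuantumFieldTheory.Balaban1983to89.B9CubeDirInversePosOnNearHY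

end
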